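import Literature.Analysis.FunctionSpaces.PoissonFKG
import Literature.Analysis.FunctionSpaces.PoissonCountConditionalMonotone
import Literature.Analysis.FunctionSpaces.DiscreteConditionalAverage
import Literature.Analysis.FunctionSpaces.PointConfigCountFiltration
import HarnessLib

/-!
# The Harris–FKG inequality for Poisson point processes — proof of the named fact

(topic Analysis/FunctionSpaces; discharges `IsPoissonPointProcess.harrisFKG` of `PoissonFKG.lean`;
no new objects.)

**Theorem** (Last–Penrose 2017, Thm. 20.4; Roy 1990, Lemma 2.3; Janson 1984).  The law `P` of a
Poisson point process with locally finite intensity `ν` on a second-countable locally compact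
Hausdorff Borel space `E` is positively associated for the inclusion order on configurations:
`P A · P B ≤ P (A ∩ B)` for measurable increasing events `A`, `B`.

**Proof** (the martingale route of Last–Penrose §20.3, made elementary).  Layers landed separately:

1. `PoissonCountFKG`: the COUNT VECTOR `(N(t j))_j` of finitely many pairwise disjoint sets of
   finite intensity is positively associated (independent Poisson coordinates + Harris' lemma on
   `ℕ^r`): `E[F(N⃗)] E[G(N⃗)] ≤ E[F(N⃗) G(N⃗)]` for monotone bounded `F`, `G`
   (`IsPoissonPointProcess.integral_mul_integral_le_integral_mul_counts`).
2a. `PoissonCountConditionalMonotone`: by the Mecke equation, the conditional probability of an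
   increasing event given the count vector is MONOTONE along the cylinders of positive probability
   (`setLIntegral_cylinder_mul_measure_le_of_le`; here `condProb_cylinder_mono`).
2b. `DiscreteConditionalAverage` + `PointConfigCountFiltration`: conditional averages over the
   fibres of a discrete random variable, and a COUNT FILTRATION — finite disjoint families
   `t k : Fin (r k) → Set E` of relatively compact measurable sets whose count σ-algebras increase
   and generate the σ-algebra of configurations, so that every event is approximated in `P`-measure
   by count cylinders of one level (`PointConfig.exists_count_cylinder_approx`).

Assembly (`harris_of_countFiltration`): fix `ε > 0` and a level `k` at which both `A` and `B` are
`ε`-close to cylinders.  The conditional averages `Φ_A = P[A | N⃗_k]`, `Φ_B` are monotone functions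
of the count vector on the (almost sure) set of positive cylinders (2a), and extend to monotone
functions on all count vectors (`exists_monotone_extension`), so layer 1 gives
`P A · P B = E[Φ_A] E[Φ_B] ≤ E[Φ_A Φ_B]`, while `|E[Φ_A Φ_B] − P(A ∩ B)| ≤ 4ε`
(`abs_integral_condAvg_mul_condAvg_sub_le`).  Letting `ε → 0` proves the inequality; the named
fact `harrisFKG_holds` plugs in the count filtration of `PointConfig.exists_count_filtration`.

## References

* G. Last, M. Penrose, *Lectures on the Poisson Process*, Cambridge University Press (2017),
  §20.3, Thm. 20.4. [cite: LastPenrose2017, Thm 20.4]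
* R. Roy, The Russo–Seymour–Welsh theorem and the equality of critical densities and the "dual"
  critical densities for continuum percolation on `ℝ²`, *Ann. Probab.* 18 (1990) 1563–1575, Lemma 2.3.
* T. E. Harris, A lower bound for the critical probability in a certain percolation process,
  *Proc. Cambridge Philos. Soc.* 56 (1960) 13–20 (Harris' lemma).
-/

namespace Literature.Analysis.FunctionSpaces

open _root_.MeasureTheory Set Filter
open scoped ENNReal

/-! ## Monotone envelopes and finite count vectors -/

/-- **Monotone upper envelope.** Let `φ : α → ℝ` take values in `[0, 1]` and be monotone ON a
set `G` (`m ≤ n`, `m n ∈ G` ⇒ `φ m ≤ φ n`).  Then `F n := sSup (φ '' {m ∈ G | m ≤ n})` is monotone on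
all of `α`, takes values in `[0, 1]`, and agrees with `φ` on `G`. [folklore] -/
theorem exists_monotone_extension {α : Type*} [Preorder α] (φ : α → ℝ) (G : Set α)
    (h0 : ∀ a, 0 ≤ φ a) (h1 : ∀ a, φ a ≤ 1)
    (hmono : ∀ m ∈ G, ∀ n ∈ G, m ≤ n → φ m ≤ φ n) :
    ∃ F : α → ℝ, Monotone F ∧ (∀ a, 0 ≤ F a) ∧ (∀ a, F a ≤ 1) ∧ ∀ a ∈ G, F a = φ a := by
  classical
  set F : α → ℝ := fun n => sSup (φ '' {m | m ∈ G ∧ m ≤ n}) with hF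
  have hbdd : ∀ n, BddAbove (φ '' {m | m ∈ G ∧ m ≤ n}) := fun n =>
    ⟨1, by rintro _ ⟨m, -, rfl⟩; exact h1 m⟩
  refine ⟨F, fun a b hab => ?_, fun a => ?_, fun a => ?_, fun a ha => ?_⟩
  · -- monotone
    by_cases hne : (φ '' {m | m ∈ G ∧ m ≤ a}).Nonempty
    · exact csSup_le_csSup (hbdd b) hne (image_mono fun m hm => ⟨hm.1, hm.2.trans hab⟩)
    · rw [not_nonempty_iff_eq_empty] at hne
      simp only [hF, hne, Real.sSup_empty]
      by_cases hne' : (φ '' {m | m ∈ G ∧ m ≤ b}).Nonempty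
      · obtain ⟨x, hx⟩ := hne'
        obtain ⟨m, hm, rfl⟩ := hx
        exact (h0 m).trans (le_csSup (hbdd b) ⟨m, hm, rfl⟩)
      · rw [not_nonempty_iff_eq_empty] at hne'
        simp [hne']
  · -- nonneg
    by_cases hne : (φ '' {m | m ∈ G ∧ m ≤ a}).Nonempty
    · obtain ⟨_, m, hm, rfl⟩ := hne
      exact (h0 m).trans (le_csSup (hbdd a) ⟨m, hm, rfl⟩)
    · rw [not_nonempty_iff_eq_empty] at hne
      simp [hF, hne]
  · -- le one
    by_cases hne : (φ '' {m | m ∈ G ∧ m ≤ a}).Nonempty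
    · exact csSup_le hne (by rintro _ ⟨m, -, rfl⟩; exact h1 m)
    · rw [not_nonempty_iff_eq_empty] at hne
      simp [hF, hne]
  · -- agrees on G
    apply le_antisymm
    · exact csSup_le ⟨φ a, a, ⟨ha, le_rfl⟩, rfl⟩ (by rintro _ ⟨m, hm, rfl⟩; exact hmono m hm.1 a ha hm.2)
    · exact le_csSup (hbdd a) ⟨a, ⟨ha, le_rfl⟩, rfl⟩

variable {E : Type*} [TopologicalSpace E] [MeasurableSpace E]

/-- A vector of counts of sets with finite counts is a vector of natural numbers. [folklore] -/
theorem exists_natCast_eq_of_forall_ne_top {r : ℕ} {v : Fin r → ℕ∞} (hv : ∀ j, v j ≠ ⊤) :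
    ∃ n : Fin r → ℕ, (fun j => (n j : ℕ∞)) = v := by
  refine ⟨fun j => (v j).toNat, funext fun j => ?_⟩
  exact ENat.coe_toNat (hv j)

/-- **Monotonicity of the conditional probabilities of an increasing event on positive
cylinders** (from layer 2a, `setLIntegral_cylinder_mul_measure_le_of_le`, with `f = 𝟙_A`): for count
vectors `v ≤ w` whose cylinders have positive probability,
`P(A ∩ C(v)) / P(C(v)) ≤ P(A ∩ C(w)) / P(C(w))`. [cite: LastPenrose2017, §20.3] -/
theorem IsPoissonPointProcess.condProb_cylinder_mono {ν : Measure E} [SigmaFinite ν]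
    {P : Measure (PointConfig E)} [IsFiniteMeasure P] (h : IsPoissonPointProcess ν P)
    [T2Space E] [SecondCountableTopology E] [BorelSpace E]
    {r : ℕ} {t : Fin r → Set E} (ht : ∀ i, MeasurableSet (t i))
    (hd : Pairwise (Function.onFun Disjoint t)) {A : Set (PointConfig E)} (hA : MeasurableSet A)
    (hup : ∀ c c' : PointConfig E, (c : Set E) ⊆ (c' : Set E) → c ∈ A → c' ∈ A)
    {n m : Fin r → ℕ} (hnm : n ≤ m)
    (hn : P {c : PointConfig E | ∀ i, c.count (t i) = (n i : ℕ∞)} ≠ 0)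
    (hm : P {c : PointConfig E | ∀ i, c.count (t i) = (m i : ℕ∞)} ≠ 0) :
    P.real (A ∩ {c : PointConfig E | ∀ i, c.count (t i) = (n i : ℕ∞)}) /
        P.real {c : PointConfig E | ∀ i, c.count (t i) = (n i : ℕ∞)} ≤
      P.real (A ∩ {c : PointConfig E | ∀ i, c.count (t i) = (m i : ℕ∞)}) /
        P.real {c : PointConfig E | ∀ i, c.count (t i) = (m i : ℕ∞)} := by
  classical
  set Cn : Set (PointConfig E) := {c | ∀ i, c.count (t i) = (n i : ℕ∞)} with hCn
  set Cm : Set (PointConfig E) := {c | ∀ i, c.count (t i) = (m i : ℕ∞)} with hCm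
  have hf : Measurable (A.indicator fun _ : PointConfig E => (1 : ℝ≥0∞)) :=
    measurable_const.indicator hA
  have hmono : ∀ c c' : PointConfig E, (c : Set E) ⊆ (c' : Set E) →
      A.indicator (fun _ => (1 : ℝ≥0∞)) c ≤ A.indicator (fun _ => (1 : ℝ≥0∞)) c' := by
    intro c c' hcc'
    by_cases hc : c ∈ A
    · rw [indicator_of_mem hc, indicator_of_mem (hup c c' hcc' hc)]
    · rw [indicator_of_notMem hc]; exact bot_le
  have key := h.setLIntegral_cylinder_mul_measure_le_of_le ht hd hf hmono hnm
  have hCnm : MeasurableSet Cn := PointConfig.measurableSet_setOf_forall_count_eq ht n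
  have hCmm : MeasurableSet Cm := PointConfig.measurableSet_setOf_forall_count_eq ht m
  rw [lintegral_indicator hA, setLIntegral_const, lintegral_indicator hA, setLIntegral_const,
    one_mul, one_mul, Measure.restrict_apply hA, Measure.restrict_apply hA] at key
  -- pass to reals and divide
  have hfinAn : P (A ∩ Cn) ≠ ∞ := measure_ne_top _ _
  have hfinAm : P (A ∩ Cm) ≠ ∞ := measure_ne_top _ _
  have hfinn : P Cn ≠ ∞ := measure_ne_top _ _
  have hfinm : P Cm ≠ ∞ := measure_ne_top _ _
  have keyR : P.real (A ∩ Cn) * P.real Cm ≤ P.real (A ∩ Cm) * P.real Cn := by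
    have := ENNReal.toReal_mono (ENNReal.mul_ne_top hfinAm hfinn) key
    simpa only [ENNReal.toReal_mul, measureReal_def] using this
  have hposn : 0 < P.real Cn := by
    rw [measureReal_def]; exact ENNReal.toReal_pos hn hfinn
  have hposm : 0 < P.real Cm := by
    rw [measureReal_def]; exact ENNReal.toReal_pos hm hfinm
  rw [div_le_div_iff₀ hposn hposm]
  exact keyR

/-! ## The assembly -/

/-- **Harris–FKG for Poisson processes, given a count filtration** (the martingale route,
elementary form).  Let `P` be a Poisson point process (probability law on configurations) with
intensity `ν`, and let `t k : Fin (r k) → Set E` (`k ∈ ℕ`) be finite pairwise disjoint measurable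
families of sets of finite intensity and surely finite counts, along which (i) count-cylinder events
are NESTED (`k ≤ k'` ⇒ every level-`k` cylinder event is a level-`k'` cylinder event) and (ii) every
event is APPROXIMABLE in measure by cylinder events.  Then increasing events are positively
correlated: `P A · P B ≤ P (A ∩ B)`.  Proof: at level `k`, the conditional probabilities of `A`, `B`
given the count vector are monotone on the cylinders of positive probability (layer 2a, Mecke) and
extend to monotone functions of the count vector, so Harris' lemma for the independent Poisson
counts (layer 1) gives `P A · P B = E[Φ_A] E[Φ_B] ≤ E[Φ_A Φ_B]`, and `E[Φ_A Φ_B] → P(A ∩ B)` as the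
cylinder approximations of `A`, `B` improve (elementary conditional averages). [cite: LastPenrose2017, Thm 20.4] -/
theorem IsPoissonPointProcess.harris_of_countFiltration [T2Space E] [SecondCountableTopology E]
    [BorelSpace E] {ν : Measure E} [SigmaFinite ν] {P : Measure (PointConfig E)}
    (hP : IsPoissonPointProcess ν P) {r : ℕ → ℕ} (t : ∀ k, Fin (r k) → Set E)
    (ht : ∀ k j, MeasurableSet (t k j)) (hd : ∀ k, Pairwise (Function.onFun Disjoint (t k)))
    (hfin : ∀ k j, ν (t k j) ≠ ∞) (hcount : ∀ (c : PointConfig E) k j, c.count (t k j) ≠ ⊤)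
    (hnest : ∀ k k', k ≤ k' → ∀ T : Set (Fin (r k) → ℕ∞), ∃ T' : Set (Fin (r k') → ℕ∞),
      (fun (c : PointConfig E) j => c.count (t k j)) ⁻¹' T =
        (fun (c : PointConfig E) j => c.count (t k' j)) ⁻¹' T')
    (happrox : ∀ A : Set (PointConfig E), MeasurableSet A → ∀ ε : ℝ, 0 < ε →
      ∃ (k : ℕ) (T : Set (Fin (r k) → ℕ∞)),
        P.real (symmDiff A ((fun (c : PointConfig E) j => c.count (t k j)) ⁻¹' T)) < ε)
    {A B : Set (PointConfig E)} (hA : MeasurableSet A) (hB : MeasurableSet B)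
    (hAup : ∀ c c' : PointConfig E, (c : Set E) ⊆ (c' : Set E) → c ∈ A → c' ∈ A)
    (hBup : ∀ c c' : PointConfig E, (c : Set E) ⊆ (c' : Set E) → c ∈ B → c' ∈ B) :
    P A * P B ≤ P (A ∩ B) := by
  classical
  haveI := hP.isProbabilityMeasure
  -- it suffices to prove the real inequality up to every ε > 0
  suffices hreal : ∀ ε : ℝ, 0 < ε → P.real A * P.real B ≤ P.real (A ∩ B) + 5 * ε by
    have hle : P.real A * P.real B ≤ P.real (A ∩ B) := by
      refine le_of_forall_pos_le_add fun ε hε => ?_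
      have := hreal (ε / 5) (by positivity)
      linarith
    have h1 : P A * P B = ENNReal.ofReal (P.real A * P.real B) := by
      rw [ENNReal.ofReal_mul measureReal_nonneg, ofReal_measureReal, ofReal_measureReal]
    rw [h1, ← ofReal_measureReal]
    exact ENNReal.ofReal_le_ofReal hle
  intro ε hε
  -- choose a common level approximating both events
  obtain ⟨kA, TA, hTA⟩ := happrox A hA ε hε
  obtain ⟨kB, TB, hTB⟩ := happrox B hB ε hε
  set k : ℕ := max kA kB with hk
  obtain ⟨TA', hTA'⟩ := hnest kA k (le_max_left _ _) TA
  obtain ⟨TB', hTB'⟩ := hnest kB k (le_max_right _ _) TB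
  rw [hTA'] at hTA
  rw [hTB'] at hTB
  -- the count vector at level `k`
  set X : PointConfig E → (Fin (r k) → ℕ∞) := fun c j => c.count (t k j) with hX
  have hXm : Measurable X := measurable_pi_lambda _ fun j => PointConfig.measurable_count (ht k j)
  -- conditional averages and their monotone envelopes
  set φ : Set (PointConfig E) → (Fin (r k) → ℕ∞) → ℝ := fun C v =>
    P.real (C ∩ X ⁻¹' {v}) / P.real (X ⁻¹' {v}) with hφ
  have hφX : ∀ C, condAvg P X C = φ C ∘ X := fun C => rfl
  set G : Set (Fin (r k) → ℕ∞) := {v | P (X ⁻¹' {v}) ≠ 0} with hG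
  -- cylinders in the two notations
  have hcyl : ∀ n : Fin (r k) → ℕ, X ⁻¹' {fun j => (n j : ℕ∞)} =
      {c : PointConfig E | ∀ i, c.count (t k i) = (n i : ℕ∞)} := by
    intro n; ext c; simp [hX, funext_iff]
  have hmonoG : ∀ C : Set (PointConfig E), MeasurableSet C →
      (∀ c c' : PointConfig E, (c : Set E) ⊆ (c' : Set E) → c ∈ C → c' ∈ C) →
      ∀ v ∈ G, ∀ w ∈ G, v ≤ w → φ C v ≤ φ C w := by
    intro C hC hCup v hv w hw hvw
    -- positive cylinders have finite count targets
    have hvfin : ∀ j, v j ≠ ⊤ := by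
      intro j hj
      apply hv
      have : X ⁻¹' {v} = ∅ := by
        ext c
        simp only [mem_preimage, mem_singleton_iff, mem_empty_iff_false, iff_false]
        intro hc
        exact hcount c k j (by rw [← hj, ← hc])
      rw [this, measure_empty]
    have hwfin : ∀ j, w j ≠ ⊤ := by
      intro j hj
      apply hw
      have : X ⁻¹' {w} = ∅ := by
        ext c
        simp only [mem_preimage, mem_singleton_iff, mem_empty_iff_false, iff_false]
        intro hc
        exact hcount c k j (by rw [← hj, ← hc])
      rw [this, measure_empty]
    obtain ⟨n, rfl⟩ := exists_natCast_eq_of_forall_ne_top hvfin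
    obtain ⟨m, rfl⟩ := exists_natCast_eq_of_forall_ne_top hwfin
    have hnm : n ≤ m := fun j => by
      have hj := hvw j
      simp only at hj
      exact_mod_cast hj
    have hn : P {c : PointConfig E | ∀ i, c.count (t k i) = (n i : ℕ∞)} ≠ 0 := by
      rwa [← hcyl]
    have hm : P {c : PointConfig E | ∀ i, c.count (t k i) = (m i : ℕ∞)} ≠ 0 := by
      rwa [← hcyl]
    have := hP.condProb_cylinder_mono (ht k) (hd k) hC hCup hnm hn hm
    simp only [hφ, hcyl]
    exact this
  -- envelopes
  have h0 : ∀ (C : Set (PointConfig E)) v, 0 ≤ φ C v := fun C v =>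
    div_nonneg measureReal_nonneg measureReal_nonneg
  have h1 : ∀ (C : Set (PointConfig E)) v, φ C v ≤ 1 := fun C v =>
    div_le_one_of_le₀ (measureReal_mono inter_subset_right (measure_ne_top _ _)) measureReal_nonneg
  obtain ⟨FA, hFAmono, -, -, hFAG⟩ :=
    exists_monotone_extension (φ A) G (h0 A) (h1 A) (hmonoG A hA hAup)
  obtain ⟨FB, hFBmono, -, -, hFBG⟩ :=
    exists_monotone_extension (φ B) G (h0 B) (h1 B) (hmonoG B hB hBup)
  -- the envelopes agree with the conditional averages almost surely
  have haeG : ∀ᵐ c ∂P, X c ∈ G := ae_measure_fiber_ne_zero P X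
  have haeA : (fun c => FA (X c)) =ᵐ[P] condAvg P X A := by
    filter_upwards [haeG] with c hc
    rw [hFAG _ hc]; rfl
  have haeB : (fun c => FB (X c)) =ᵐ[P] condAvg P X B := by
    filter_upwards [haeG] with c hc
    rw [hFBG _ hc]; rfl
  -- Harris for the independent Poisson counts (layer 1)
  have harris := hP.integral_mul_integral_le_integral_mul_counts (ht k) (hd k) (hfin k) hFAmono hFBmono
  have eA : ∫ c, FA (fun j => c.count (t k j)) ∂P = P.real A := by
    rw [show (fun c : PointConfig E => FA (fun j => c.count (t k j))) = fun c => FA (X c) from rfl,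
      integral_congr_ae haeA, integral_condAvg hXm hA]
  have eB : ∫ c, FB (fun j => c.count (t k j)) ∂P = P.real B := by
    rw [show (fun c : PointConfig E => FB (fun j => c.count (t k j))) = fun c => FB (X c) from rfl,
      integral_congr_ae haeB, integral_condAvg hXm hB]
  have eAB : ∫ c, FA (fun j => c.count (t k j)) * FB (fun j => c.count (t k j)) ∂P =
      ∫ c, condAvg P X A c * condAvg P X B c ∂P := by
    refine integral_congr_ae ?_
    filter_upwards [haeA, haeB] with c hcA hcB
    change FA (X c) * FB (X c) = _
    rw [hcA, hcB]
  rw [eA, eB, eAB] at harris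
  -- the product of conditional averages is close to `P (A ∩ B)`
  have hprod := abs_integral_condAvg_mul_condAvg_sub_le (μ := P) hXm hA hB TA' TB'
  have hlt : 2 * P.real (symmDiff A (X ⁻¹' TA')) + 2 * P.real (symmDiff B (X ⁻¹' TB')) < 4 * ε := by
    have h1' : P.real (symmDiff A (X ⁻¹' TA')) < ε := hTA
    have h2' : P.real (symmDiff B (X ⁻¹' TB')) < ε := hTB
    linarith
  have := (abs_sub_lt_iff.1 (hprod.trans_lt hlt)).1
  linarith

/-- **Harris–FKG inequality for Poisson point processes** (Last–Penrose 2017, Thm. 20.4), the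
named fact `IsPoissonPointProcess.harrisFKG` DISCHARGED: the law of a Poisson point process with
locally finite intensity on a second-countable locally compact Hausdorff Borel space is positively
associated for the inclusion order on configurations.  From `harris_of_countFiltration` along the
count filtration of `PointConfig.exists_count_filtration` (relatively compact cells have finite
intensity and finite counts; cylinder events are nested along the filtration because the count
σ-algebras increase; events are approximable by `PointConfig.exists_count_cylinder_approx`).
[cite: LastPenrose2017, Thm 20.4] -/
theorem IsPoissonPointProcess.harrisFKG_holds : IsPoissonPointProcess.harrisFKG := by
  intro E _ _ _ _ _ _ ν _ P hP A B hAup hBup hA hB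
  classical
  haveI := hP.isProbabilityMeasure
  obtain ⟨r, t, htK, hd, hmono, hgen⟩ := PointConfig.exists_count_filtration (E := E)
  refine hP.harris_of_countFiltration t (fun k j => (htK k j).1) hd ?_ ?_ ?_ ?_ hA hB
    (fun c c' h hc => hAup (PointConfig.le_iff_coe_subset.2 h) hc)
    (fun c c' h hc => hBup (PointConfig.le_iff_coe_subset.2 h) hc)
  · intro k j
    obtain ⟨K, hK, hsub⟩ := (htK k j).2
    exact ((measure_mono hsub).trans_lt hK.measure_lt_top).ne
  · intro c k j
    obtain ⟨K, hK, hsub⟩ := (htK k j).2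
    exact ((c.count_mono hsub).trans_lt (c.count_lt_top_of_isCompact hK)).ne
  · intro k k' hkk' T
    have hmeas : MeasurableSet[⨆ j, (⊤ : MeasurableSpace ℕ∞).comap
        fun c : PointConfig E => c.count (t k' j)]
        ((fun (c : PointConfig E) j => c.count (t k j)) ⁻¹' T) :=
      hmono hkk' _ ((PointConfig.measurableSet_iSup_comap_count_iff (t k)).2 ⟨T, rfl⟩)
    obtain ⟨T', hT'⟩ := (PointConfig.measurableSet_iSup_comap_count_iff (t k')).1 hmeas
    exact ⟨T', hT'.symm⟩
  · intro A hA ε hε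
    exact PointConfig.exists_count_cylinder_approx hmono hgen P hA hε

end Literature.Analysis.FunctionSpaces
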